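import Literature.Computability.Complexity.PlumbingBricks
import Literature.Computability.Complexity.CountingHierarchyPPoly
import Literature.Computability.Complexity.BPPErrorReduction
import Literature.Computability.Complexity.ApproximateCounting

/-!
# Glue `PseudorandomTwinsImplyTarget` (stmt-PneNP-2723), part 1: the coin-length-advice threshold test

Route PneNP/PhaseTwins, support item stmt-PneNP-2723
(`Summit.PneNP.PneNP.Theses.PhaseTwins.PseudorandomTwinsImplyTarget`). Clause (i) of the crux
`PseudorandomTwinsAbove` quantifies over INDEX-FREE probabilistic polynomial-time tests
`A : RandAlg (List Bool) Bool` whose coin budget `A.coinLen` is an arbitrary polynomially bounded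
function of the input length. This file provides the one test the glue needs
(`AdviceTest.exists_adviceTest`): for a transducer `F ∈ FP` (the hypothetical FBPP approximator of
`¬X`), a padding polynomial `r`, a coin polynomial `M`, accuracy/confidence `kη, kδ` and an ADVICE
function `adv : ℕ → ℕ` bounded by a polynomial, there is a PPT test `A` with

  `Pr[A(x) = 1] = Pr_{u ∈ {0,1}^{M|x|}}[adv |x| < |F ⟨x, 1^{r|x|}, 1^{kη}, 1^{kδ}, u⟩|]`.

The test reads `x` and coins `w` with `|w| = M |x| + adv |x|`, runs `F` on the counting query
`⟨x, 1^{r|x|}, 1^{kη}, 1^{kδ}, w ↾ M|x|⟩` (`countQuery`) and accepts iff the raw answer is LONGER than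
the number `adv |x| = |w ⇂ M|x||` of surplus coins (read in binary the answer is then
`≥ 2^{adv |x| - 1}`): a threshold test whose threshold octave is written into the coin budget. Its
run map is an `FP` string function assembled from the brick algebra (`polyFn`, `takeFn`, `dropFn`,
`fanoutFn`, `lenLeFn`, `notFn`; no machine is written), and the surplus coins only carry their
number (`uniformProb_take_add`, `uniformProb_congr`, `RandAlg.pr_eq_uniformProb` from the tree).

References: S. Arora, B. Barak, *Computational Complexity: A Modern Approach*, CUP 2009, §7.1
(random-tape machines), §6.3 (advice); S. Aaronson, A. Arkhipov, Theory of Computing 9 (2013),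
Def. 2.4 (FBPP query format).
-/

set_option linter.dupNamespace false -- `Summit.PneNP.PneNP.…`: summit = sub-problem (D-0017)

namespace Summit.PneNP.PneNP.Theorems

open Literature.Computability.Complexity Literature.Computability.Complexity.Brick
  Literature.Computability.Complexity.Plumb Polynomial
open _root_.Computability

namespace AdviceTest

/-- The string function of the test: on `⟨x, w⟩`, the one-symbol verdict
`[|w ⇂ M|x|| < |F ⟨x, 1^{r|x|}, 1^{kη}, 1^{kδ}, w ↾ M|x|⟩|]`, is in `FP` for `F ∈ FP`. [folklore] -/
theorem testFn_mem_FP {F : List Bool → List Bool} (hF : F ∈ FP) (r M : Polynomial ℕ) (kη kδ : ℕ) :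
    notFn (lenLeFn X ∘ fanoutFn (dropFn ∘ fanoutFn (polyFn M ∘ fstF) sndF)
      (F ∘ fanoutFn (fanoutFn fstF (fanoutFn (polyFn r ∘ fstF)
        (fun _ => boolPair (unaryEncodeNat kη) (unaryEncodeNat kδ))))
        (takeFn ∘ fanoutFn (polyFn M ∘ fstF) sndF))) ∈ FP :=
  notFn_mem_FP (comp_mem_FP (lenLeFn_mem_FP X) (fanoutFn_mem_FP
    (comp_mem_FP dropFn_mem_FP (fanoutFn_mem_FP (comp_mem_FP (polyFn_mem_FP M) fstF_mem_FP)
      sndF_mem_FP))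
    (comp_mem_FP hF (fanoutFn_mem_FP (fanoutFn_mem_FP fstF_mem_FP (fanoutFn_mem_FP
      (comp_mem_FP (polyFn_mem_FP r) fstF_mem_FP) (const_mem_FP _)))
      (comp_mem_FP takeFn_mem_FP (fanoutFn_mem_FP (comp_mem_FP (polyFn_mem_FP M) fstF_mem_FP)
        sndF_mem_FP))))))

/-- Value of the string function of the test on a pair `⟨x, w⟩`. [folklore] -/
theorem testFn_boolPair (F : List Bool → List Bool) (r M : Polynomial ℕ) (kη kδ : ℕ)
    (x w : List Bool) :
    notFn (lenLeFn X ∘ fanoutFn (dropFn ∘ fanoutFn (polyFn M ∘ fstF) sndF)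
      (F ∘ fanoutFn (fanoutFn fstF (fanoutFn (polyFn r ∘ fstF)
        (fun _ => boolPair (unaryEncodeNat kη) (unaryEncodeNat kδ))))
        (takeFn ∘ fanoutFn (polyFn M ∘ fstF) sndF))) (boolPair x w) =
      [decide ((w.drop (M.eval x.length)).length <
        (F (countQuery x (r.eval x.length) kη kδ (w.take (M.eval x.length)))).length)] := by
  have hq : (F ∘ fanoutFn (fanoutFn fstF (fanoutFn (polyFn r ∘ fstF)
        (fun _ => boolPair (unaryEncodeNat kη) (unaryEncodeNat kδ))))
        (takeFn ∘ fanoutFn (polyFn M ∘ fstF) sndF)) (boolPair x w) =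
      F (countQuery x (r.eval x.length) kη kδ (w.take (M.eval x.length))) := by
    simp [countQuery, OracleCompose.unaryEncodeNat_eq_replicate]
  have hv : (dropFn ∘ fanoutFn (polyFn M ∘ fstF) sndF) (boolPair x w) = w.drop (M.eval x.length) := by
    simp
  have h1 : (lenLeFn X ∘ fanoutFn (dropFn ∘ fanoutFn (polyFn M ∘ fstF) sndF)
      (F ∘ fanoutFn (fanoutFn fstF (fanoutFn (polyFn r ∘ fstF)
        (fun _ => boolPair (unaryEncodeNat kη) (unaryEncodeNat kδ))))
        (takeFn ∘ fanoutFn (polyFn M ∘ fstF) sndF))) (boolPair x w) =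
      [decide ((F (countQuery x (r.eval x.length) kη kδ (w.take (M.eval x.length)))).length ≤
        (w.drop (M.eval x.length)).length)] := by
    rw [Function.comp_apply, fanoutFn_apply, hq, hv, lenLeFn_boolPair, eval_X]
  rw [notFn_apply h1]
  by_cases hle : (F (countQuery x (r.eval x.length) kη kδ (w.take (M.eval x.length)))).length ≤
      (w.drop (M.eval x.length)).length
  · rw [decide_eq_true hle, decide_eq_false (not_lt.2 hle)]; rfl
  · rw [decide_eq_false hle, decide_eq_true (not_le.1 hle)]; rfl

/-- **The advice threshold test.** For `F ∈ FP`, polynomials `r`, `M`, parameters `kη`, `kδ` and a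
polynomially bounded advice function `adv` (computable or not: `RandAlg.IsPolyTime` bounds `coinLen`
only polynomially) there is a PPT test whose acceptance probability on `x` is the probability, over
the `M|x|` coins `u` of `F`, that the raw answer of `F` on `⟨x, 1^{r|x|}, 1^{kη}, 1^{kδ}, u⟩` is longer
than `adv |x|`. The test: coin budget `M ℓ + adv ℓ`; cut the first `M|x|` coins `u` out of `w`, run
`F`, accept iff the answer has more symbols than there are surplus coins. [this work] -/
theorem exists_adviceTest {F : List Bool → List Bool} (hF : F ∈ FP) (r M : Polynomial ℕ)
    (kη kδ : ℕ) (adv : ℕ → ℕ) {B : Polynomial ℕ} (hadv : ∀ ℓ, adv ℓ ≤ B.eval ℓ) :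
    ∃ A : RandAlg (List Bool) Bool, A.IsPolyTime (id : List Bool → List Bool) encodeBool ∧
      ∀ x : List Bool, A.pr id x {b | b = true} =
        uniformProb (M.eval x.length)
          {u | adv x.length < (F (countQuery x (r.eval x.length) kη kδ u)).length} := by
  refine ⟨RandAlg.mk (fun x w => decide ((w.drop (M.eval x.length)).length <
      (F (countQuery x (r.eval x.length) kη kδ (w.take (M.eval x.length)))).length))
      (fun ℓ => M.eval ℓ + adv ℓ), ⟨?_, M + B, fun ℓ => ?_⟩, fun x => ?_⟩
  · -- polynomial time: the run map is the string function `testFn`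
    obtain ⟨p, T, hT⟩ := testFn_mem_FP hF r M kη kδ
    refine ⟨p, T, fun z => ?_⟩
    have h := hT (boolPair z.1 z.2)
    rw [testFn_boolPair F r M kη kδ] at h
    exact h
  · -- coin budget
    change M.eval ℓ + adv ℓ ≤ (M + B).eval ℓ
    rw [eval_add]
    exact Nat.add_le_add_left (hadv ℓ) _
  · -- acceptance probability: the surplus coins only carry their number
    rw [RandAlg.pr_eq_uniformProb]
    change uniformProb (M.eval x.length + adv x.length) _ = _
    rw [uniformProb_congr (E' := {y | y.take (M.eval x.length) ∈
        {u | adv x.length < (F (countQuery x (r.eval x.length) kη kδ u)).length}}) ?_]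
    · exact uniformProb_take_add _ _ _
    · intro y hy
      have hd : (y.drop (M.eval x.length)).length = adv x.length := by
        rw [List.length_drop, hy]; omega
      simp only [Set.mem_setOf_eq, hd, decide_eq_true_eq]

end AdviceTest

end Summit.PneNP.PneNP.Theorems
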